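import Mathlib
import HarnessLib
import Summits.Ventures.LatticeQCDFlow.Scoring.SelfNormalisedReweightingStudentisedCLT
import Summits.Ventures.LatticeQCDFlow.Scoring.IndependentSumLimit

/-!
# The A-versus-B AGREEMENT TEST made exact: for two independent codes sampling the same target,
# the studentised difference of their printed observable columns
# `(Sₙ^A − Sₙ^B)/√(V̂ₙ^A + V̂ₙ^B)` converges in distribution to `N(0, 1)` — "within `1σ_comb`" has
# asymptotically its nominal coverage

HONEST FRAMING: exact (Metropolis-corrected) sampling algorithms for lattice gauge theory;
figures of merit are autocorrelation/cost numbers at stated couplings and volumes; no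
continuum-physics claim.

Venture `LatticeQCDFlow` (cell pub-lqcd), topic `Scoring`; FANOUT row 4 (`s0-u1-b`, rung S0-B:
two independent codes compared column by column; acceptance criterion "A vs B within
`1σ_comb`").  Codes `A` and `B` propose from their own models `q_A, q_B` for ONE normalised
target `p`, each along its own independent stream on its own probability space, printing weights
with their own normalisations, the self-normalised estimate `Sₙ` of `E_p O` and its squared
standard error `V̂ₙ` (`Scoring/SelfNormalisedErrorBarConsistency`: `n·V̂ₙ → σ²` a.s.;
`Scoring/SelfNormalisedReweightingCLT`: `√n (Sₙ − E_p O) ⇒ N(0, σ²)`).  Read on the product space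
`P_A ⊗ P_B` the two centred columns are independent and converge jointly
(`Scoring/IndependentSumLimit`, `tendstoInDistribution_sub_twoCodes`), so
`√n (Sₙ^A − Sₙ^B) ⇒ σ_A Y₁ − σ_B Y₂` with `Y₁ ⟂ Y₂` standard normal;
`n(V̂ₙ^A + V̂ₙ^B) → σ_A² + σ_B²` almost surely; Slutsky and the eventual-agreement device give
**`(Sₙ^A − Sₙ^B)/√(V̂ₙ^A + V̂ₙ^B) ⇒ (σ_A Y₁ − σ_B Y₂)/√(σ_A² + σ_B²)`**, whose law is `N(0, 1)`
(**`hasLaw_twoCode_limit`**, Mathlib's `gaussianReal_add_gaussianReal_of_indepFun`).  NEW WORK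
of the cell; no definition is introduced; nothing is cited as a fact (the two-sample z-test is
folklore).

## Content (`a = ∫ p·O dμ`; `σ_X² = ∫ (p²/q_X)(O − a)² dμ`; printed `Sₙ`, `V̂ₙ` as in
## `Scoring/SelfNormalisedReweightingStudentisedCLT`)

* `twoCode_studentise_eq` — the algebra `(S^A − S^B)/√(V^A + V^B) = √n(…)/√(n V^A + n V^B)`;
* `hasLaw_twoCode_limit` — `(σ_A Y₁ − σ_B Y₂)/√(σ_A² + σ_B²) ∼ N(0, 1)` for independent standard
  normals and `σ_A² + σ_B² > 0`;
* **`twoCode_agreement_clt`** — THE THEOREM.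

NOT CLAIMED: unequal sample sizes `n_A ≠ n_B` (same proof with two indices); the acceptance and
ESS columns (their one-code studentised CLTs are on the tree; the same two lemmas apply); any
number of ours re-scored.
-/

noncomputable section

namespace Summit.Ventures.LatticeQCDFlow.Scoring.CardConsistency

open MeasureTheory ProbabilityTheory Finset Real Filter
open scoped Topology Function

/-! ## §1 Algebra and the limit law -/

section Algebra

/-- `(S^A − S^B)/√(V^A + V^B) = (√n(S^A − a) − √n(S^B − a))/√(nV^A + nV^B)` for `n ≥ 1`. [ours] -/
theorem twoCode_studentise_eq {n : ℕ} (hn : 1 ≤ n) (SA SB a VA VB : ℝ) :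
    (SA - SB) / Real.sqrt (VA + VB)
      = (Real.sqrt n * (SA - a) - Real.sqrt n * (SB - a)) / Real.sqrt (n * VA + n * VB) := by
  have hn0 : (0 : ℝ) < n := by exact_mod_cast hn
  have hsq : Real.sqrt n ≠ 0 := (Real.sqrt_pos.2 hn0).ne'
  rw [← mul_add, Real.sqrt_mul hn0.le, ← mul_sub, mul_div_mul_left _ _ hsq]
  ring_nf

variable {Ω' : Type*} [MeasurableSpace Ω'] {P' : Measure Ω'} {Y₁ Y₂ : Ω' → ℝ}

/-- **The limit is standard normal**: for independent standard normals `Y₁, Y₂` and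
`s_A, s_B ≥ 0` with `s_A + s_B > 0`, `(√s_A·Y₁ − √s_B·Y₂)/√(s_A + s_B) ∼ N(0, 1)`. [ours] -/
theorem hasLaw_twoCode_limit (hY1 : HasLaw Y₁ (gaussianReal 0 1) P')
    (hY2 : HasLaw Y₂ (gaussianReal 0 1) P') (hind : IndepFun Y₁ Y₂ P') {sA sB : ℝ}
    (hsA : 0 ≤ sA) (hsB : 0 ≤ sB) (hs : 0 < sA + sB) :
    HasLaw (fun ω' => (Real.sqrt sA * Y₁ ω' - Real.sqrt sB * Y₂ ω') / Real.sqrt (sA + sB))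
      (gaussianReal 0 1) P' := by
  have hA := hasLaw_sqrt_mul_gaussian hY1 hsA
  have hB' := gaussianReal_const_mul hY2 (-Real.sqrt sB)
  rw [mul_zero] at hB'
  have eB : NNReal.mk ((-Real.sqrt sB) ^ 2) (sq_nonneg _) * (1 : NNReal) = sB.toNNReal :=
    NNReal.eq (by simp [Real.sq_sqrt hsB, Real.coe_toNNReal _ hsB])
  rw [eB] at hB'
  -- the independent sum `√s_A Y₁ + (−√s_B) Y₂ ∼ N(0, s_A + s_B)`
  have hindAB : IndepFun (fun ω' => Real.sqrt sA * Y₁ ω') (fun ω' => -Real.sqrt sB * Y₂ ω') P' :=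
    hind.comp (measurable_const_mul _) (measurable_const_mul _)
  have hsum := gaussianReal_add_gaussianReal_of_indepFun hindAB hA.map_eq hB'.map_eq
  rw [add_zero, ← Real.toNNReal_add hsA hsB] at hsum
  have hsumLaw : HasLaw (fun ω' => Real.sqrt sA * Y₁ ω' - Real.sqrt sB * Y₂ ω')
      (gaussianReal 0 (sA + sB).toNNReal) P' := by
    refine ⟨((hY1.aemeasurable.const_mul _).sub (hY2.aemeasurable.const_mul _)), ?_⟩
    have e : (fun ω' => Real.sqrt sA * Y₁ ω' - Real.sqrt sB * Y₂ ω')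
        = (fun ω' => Real.sqrt sA * Y₁ ω') + fun ω' => -Real.sqrt sB * Y₂ ω' := by
      funext ω'
      simp only [Pi.add_apply]
      ring
    rw [e]
    exact hsum
  -- rescale by `1/√(s_A + s_B)`
  have h := gaussianReal_const_mul hsumLaw (Real.sqrt (sA + sB))⁻¹
  rw [mul_zero] at h
  have e1 : NNReal.mk ((Real.sqrt (sA + sB))⁻¹ ^ 2) (sq_nonneg _) * (sA + sB).toNNReal = 1 := by
    apply NNReal.eq
    have hs' : Real.sqrt (sA + sB) ^ 2 = sA + sB := Real.sq_sqrt hs.le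
    simp only [NNReal.coe_mul, NNReal.coe_mk, Real.coe_toNNReal _ hs.le, NNReal.coe_one, inv_pow,
      hs']
    field_simp
  rw [e1] at h
  have e2 : (fun ω' => (Real.sqrt (sA + sB))⁻¹ * (Real.sqrt sA * Y₁ ω' - Real.sqrt sB * Y₂ ω'))
      = fun ω' => (Real.sqrt sA * Y₁ ω' - Real.sqrt sB * Y₂ ω') / Real.sqrt (sA + sB) := by
    funext ω'
    rw [inv_mul_eq_div]
  rw [e2] at h
  exact h

end Algebra

/-! ## §2 The agreement test -/

section Agreement

variable {ΩA : Type*} [MeasurableSpace ΩA] {PA : Measure ΩA} [IsProbabilityMeasure PA]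
variable {ΩB : Type*} [MeasurableSpace ΩB] {PB : Measure ΩB} [IsProbabilityMeasure PB]
variable {Ω' : Type*} [MeasurableSpace Ω'] {P' : Measure Ω'} [IsProbabilityMeasure P']
variable {X : Type*} [MeasurableSpace X] {μ : Measure X} {p q q' O : X → ℝ}
variable {y : ℕ → ΩA → X} {y' : ℕ → ΩB → X} {Y₁ Y₂ : Ω' → ℝ}

/-- **THE TWO-CODE AGREEMENT TEST IS ASYMPTOTICALLY EXACT.**  Codes `A` (stream `yᵢ` on
`(Ω_A, P_A)`, model `q_A > 0`, weights `w̃ = c_A·p/q_A`, `c_A ≠ 0`) and `B` (likewise with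
`q_B`, `c_B`) sample ONE normalised target `p` and print, for a measurable observable `O` with
the second-moment hypotheses of `Scoring/SelfNormalisedReweightingCLT` under both models, the
self-normalised estimates `Sₙ^A, Sₙ^B` of `E_p O` and their squared standard errors `V̂ₙ^A, V̂ₙ^B`;
`σ_A² + σ_B² > 0`; `Y₁ ⟂ Y₂` standard normals.  Then on the product space `P_A ⊗ P_B`,
`(Sₙ^A − Sₙ^B)/√(V̂ₙ^A + V̂ₙ^B) ⇒ (σ_A Y₁ − σ_B Y₂)/√(σ_A² + σ_B²)`, a standard normal variable
(`hasLaw_twoCode_limit`). [ours] -/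
theorem twoCode_agreement_clt (hym : ∀ j, Measurable (y j)) (hind : iIndepFun y PA)
    (hlaw : ∀ j, Measure.map (y j) PA = μ.withDensity fun z => ENNReal.ofReal (q z))
    (hym' : ∀ j, Measurable (y' j)) (hind' : iIndepFun y' PB)
    (hlaw' : ∀ j, Measure.map (y' j) PB = μ.withDensity fun z => ENNReal.ofReal (q' z))
    (hpm : Measurable p) (hpi : Integrable p μ) (hp1 : ∫ z, p z ∂μ = 1) (hOm : Measurable O)
    (hpO : Integrable (fun z => p z * O z) μ)
    (hq0 : ∀ z, 0 < q z) (hqm : Measurable q) (hM2i : Integrable (fun z => p z ^ 2 / q z) μ)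
    (hT1i : Integrable (fun z => p z ^ 2 / q z * O z) μ)
    (hT2i : Integrable (fun z => p z ^ 2 / q z * O z ^ 2) μ)
    (hq0' : ∀ z, 0 < q' z) (hqm' : Measurable q') (hM2i' : Integrable (fun z => p z ^ 2 / q' z) μ)
    (hT1i' : Integrable (fun z => p z ^ 2 / q' z * O z) μ)
    (hT2i' : Integrable (fun z => p z ^ 2 / q' z * O z ^ 2) μ)
    (hs : 0 < (∫ z, p z ^ 2 / q z * (O z - ∫ x, p x * O x ∂μ) ^ 2 ∂μ)
      + ∫ z, p z ^ 2 / q' z * (O z - ∫ x, p x * O x ∂μ) ^ 2 ∂μ)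
    {wt wt' : X → ℝ} {c c' : ℝ} (hc : c ≠ 0) (hwt : ∀ z, wt z = c * (p z / q z)) (hc' : c' ≠ 0)
    (hwt' : ∀ z, wt' z = c' * (p z / q' z)) (hY1 : HasLaw Y₁ (gaussianReal 0 1) P')
    (hY2 : HasLaw Y₂ (gaussianReal 0 1) P') (hY12 : IndepFun Y₁ Y₂ P') :
    TendstoInDistribution (fun (n : ℕ) (ω : ΩA × ΩB) =>
        ((∑ i ∈ range n, wt (y i ω.1) * O (y i ω.1)) / (∑ i ∈ range n, wt (y i ω.1))
          - (∑ i ∈ range n, wt' (y' i ω.2) * O (y' i ω.2)) / (∑ i ∈ range n, wt' (y' i ω.2)))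
        / Real.sqrt
          ((∑ i ∈ range n, wt (y i ω.1) ^ 2 * (O (y i ω.1)
              - (∑ j ∈ range n, wt (y j ω.1) * O (y j ω.1)) / (∑ j ∈ range n, wt (y j ω.1))) ^ 2)
            / (∑ i ∈ range n, wt (y i ω.1)) ^ 2
          + (∑ i ∈ range n, wt' (y' i ω.2) ^ 2 * (O (y' i ω.2)
              - (∑ j ∈ range n, wt' (y' j ω.2) * O (y' j ω.2)) / (∑ j ∈ range n, wt' (y' j ω.2)))
                ^ 2) / (∑ i ∈ range n, wt' (y' i ω.2)) ^ 2))
      atTop (fun ω' => (Real.sqrt (∫ z, p z ^ 2 / q z * (O z - ∫ x, p x * O x ∂μ) ^ 2 ∂μ) * Y₁ ω'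
          - Real.sqrt (∫ z, p z ^ 2 / q' z * (O z - ∫ x, p x * O x ∂μ) ^ 2 ∂μ) * Y₂ ω')
        / Real.sqrt ((∫ z, p z ^ 2 / q z * (O z - ∫ x, p x * O x ∂μ) ^ 2 ∂μ)
          + ∫ z, p z ^ 2 / q' z * (O z - ∫ x, p x * O x ∂μ) ^ 2 ∂μ))
      (fun _ => PA.prod PB) P' := by
  -- abbreviations
  obtain ⟨a, ha⟩ : ∃ a : ℝ, a = ∫ x, p x * O x ∂μ := ⟨_, rfl⟩
  have hsA0 : 0 ≤ ∫ z, p z ^ 2 / q z * (O z - ∫ x, p x * O x ∂μ) ^ 2 ∂μ :=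
    integral_nonneg fun z => mul_nonneg (div_nonneg (sq_nonneg _) (hq0 z).le) (sq_nonneg _)
  have hsB0 : 0 ≤ ∫ z, p z ^ 2 / q' z * (O z - ∫ x, p x * O x ∂μ) ^ 2 ∂μ :=
    integral_nonneg fun z => mul_nonneg (div_nonneg (sq_nonneg _) (hq0' z).le) (sq_nonneg _)
  -- the two one-code central limit theorems, with limits `√s_A·Y₁`, `√s_B·Y₂`
  have hcltA := selfNormReweighting_clt (P' := P') hym hind hlaw hpm hpi hp1 hq0 hqm hOm hpO
    hM2i hT1i hT2i hc hwt (hasLaw_sqrt_mul_gaussian hY1 hsA0)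
  have hcltB := selfNormReweighting_clt (P' := P') hym' hind' hlaw' hpm hpi hp1 hq0' hqm' hOm
    hpO hM2i' hT1i' hT2i' hc' hwt' (hasLaw_sqrt_mul_gaussian hY2 hsB0)
  -- the two variance columns, almost surely under each code
  have hVA := selfNormErrorBar_tendsto_ae hym hind hlaw hpm hpi hp1 hq0 hqm hOm hpO hM2i hT1i
    hT2i hc hwt
  have hVB := selfNormErrorBar_tendsto_ae hym' hind' hlaw' hpm hpi hp1 hq0' hqm' hOm hpO hM2i'
    hT1i' hT2i' hc' hwt'
  obtain ⟨sA, hsA⟩ : ∃ s : ℝ, s = ∫ z, p z ^ 2 / q z * (O z - ∫ x, p x * O x ∂μ) ^ 2 ∂μ :=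
    ⟨_, rfl⟩
  obtain ⟨sB, hsB⟩ : ∃ s : ℝ, s = ∫ z, p z ^ 2 / q' z * (O z - ∫ x, p x * O x ∂μ) ^ 2 ∂μ :=
    ⟨_, rfl⟩
  rw [← hsA, ← hsB] at hs ⊢
  rw [← hsA] at hcltA hVA hsA0
  rw [← hsB] at hcltB hVB hsB0
  rw [← ha] at hcltA hcltB
  -- joint limit of the difference on the product space
  have hdiff := tendstoInDistribution_sub_twoCodes (PA := PA) (PB := PB) hcltA hcltB
    (hY12.comp (measurable_const_mul _) (measurable_const_mul _))
  -- the pooled variance on the product space: `nV̂^A(ω.1) + nV̂^B(ω.2) → s_A + s_B` a.s.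
  have hVA' := (Measure.quasiMeasurePreserving_fst (μ := PA) (ν := PB)).ae hVA
  have hVB' := (Measure.quasiMeasurePreserving_snd (μ := PA) (ν := PB)).ae hVB
  have hwtm : Measurable wt := by
    rw [show wt = fun z => c * (p z / q z) from funext hwt]
    exact (hpm.div hqm).const_mul c
  have hwtm' : Measurable wt' := by
    rw [show wt' = fun z => c' * (p z / q' z) from funext hwt']
    exact (hpm.div hqm').const_mul c'
  -- measurability of the one-code pieces
  have hSAm : ∀ n : ℕ, Measurable fun ω : ΩA =>
      (∑ j ∈ range n, wt (y j ω) * O (y j ω)) / (∑ j ∈ range n, wt (y j ω)) := fun n =>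
    (Finset.measurable_sum _ fun j _ => (hwtm.comp (hym j)).mul (hOm.comp (hym j))).div
      (Finset.measurable_sum _ fun j _ => hwtm.comp (hym j))
  have hSBm : ∀ n : ℕ, Measurable fun ω : ΩB =>
      (∑ j ∈ range n, wt' (y' j ω) * O (y' j ω)) / (∑ j ∈ range n, wt' (y' j ω)) := fun n =>
    (Finset.measurable_sum _ fun j _ => (hwtm'.comp (hym' j)).mul (hOm.comp (hym' j))).div
      (Finset.measurable_sum _ fun j _ => hwtm'.comp (hym' j))
  have hVAm : ∀ n : ℕ, Measurable fun ω : ΩA => (∑ i ∈ range n, wt (y i ω) ^ 2 * (O (y i ω)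
      - (∑ j ∈ range n, wt (y j ω) * O (y j ω)) / (∑ j ∈ range n, wt (y j ω))) ^ 2)
        / (∑ i ∈ range n, wt (y i ω)) ^ 2 := fun n =>
    (Finset.measurable_sum _ fun i _ => ((hwtm.comp (hym i)).pow_const 2).mul
      (((hOm.comp (hym i)).sub (hSAm n)).pow_const 2)).div
      ((Finset.measurable_sum _ fun i _ => hwtm.comp (hym i)).pow_const 2)
  have hVBm : ∀ n : ℕ, Measurable fun ω : ΩB => (∑ i ∈ range n, wt' (y' i ω) ^ 2 * (O (y' i ω)
      - (∑ j ∈ range n, wt' (y' j ω) * O (y' j ω)) / (∑ j ∈ range n, wt' (y' j ω))) ^ 2)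
        / (∑ i ∈ range n, wt' (y' i ω)) ^ 2 := fun n =>
    (Finset.measurable_sum _ fun i _ => ((hwtm'.comp (hym' i)).pow_const 2).mul
      (((hOm.comp (hym' i)).sub (hSBm n)).pow_const 2)).div
      ((Finset.measurable_sum _ fun i _ => hwtm'.comp (hym' i)).pow_const 2)
  have hVm : ∀ n : ℕ, Measurable fun ω : ΩA × ΩB =>
      (n : ℝ) * ((∑ i ∈ range n, wt (y i ω.1) ^ 2 * (O (y i ω.1)
        - (∑ j ∈ range n, wt (y j ω.1) * O (y j ω.1)) / (∑ j ∈ range n, wt (y j ω.1))) ^ 2)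
          / (∑ i ∈ range n, wt (y i ω.1)) ^ 2)
      + (n : ℝ) * ((∑ i ∈ range n, wt' (y' i ω.2) ^ 2 * (O (y' i ω.2)
        - (∑ j ∈ range n, wt' (y' j ω.2) * O (y' j ω.2)) / (∑ j ∈ range n, wt' (y' j ω.2))) ^ 2)
          / (∑ i ∈ range n, wt' (y' i ω.2)) ^ 2) := fun n =>
    (((hVAm n).comp measurable_fst).const_mul _).add (((hVBm n).comp measurable_snd).const_mul _)
  have hVae : ∀ᵐ ω ∂PA.prod PB, Tendsto (fun n : ℕ =>
      (n : ℝ) * ((∑ i ∈ range n, wt (y i ω.1) ^ 2 * (O (y i ω.1)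
        - (∑ j ∈ range n, wt (y j ω.1) * O (y j ω.1)) / (∑ j ∈ range n, wt (y j ω.1))) ^ 2)
          / (∑ i ∈ range n, wt (y i ω.1)) ^ 2)
      + (n : ℝ) * ((∑ i ∈ range n, wt' (y' i ω.2) ^ 2 * (O (y' i ω.2)
        - (∑ j ∈ range n, wt' (y' j ω.2) * O (y' j ω.2)) / (∑ j ∈ range n, wt' (y' j ω.2))) ^ 2)
          / (∑ i ∈ range n, wt' (y' i ω.2)) ^ 2)) atTop (𝓝 (sA + sB)) := by
    filter_upwards [hVA', hVB'] with ω hA hB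
    exact hA.add hB
  have hV := tendstoInMeasure_of_tendsto_ae (fun n => (hVm n).aestronglyMeasurable) hVae
  -- Slutsky with `g(x, v) = x/√(max(v, s/2))`, `s = s_A + s_B`
  have hden : ∀ v : ℝ, Real.sqrt (max v ((sA + sB) / 2)) ≠ 0 := fun v =>
    (Real.sqrt_pos.2 (lt_max_of_lt_right (half_pos hs))).ne'
  have hgc : Continuous fun z : ℝ × ℝ => z.1 / Real.sqrt (max z.2 ((sA + sB) / 2)) :=
    continuous_fst.div (continuous_snd.max continuous_const).sqrt fun z => hden z.2
  have hsl := hdiff.continuous_comp_prodMk_of_tendstoInMeasure_const hgc hV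
    (fun n => (hVm n).aemeasurable)
  have elim : (fun ω' => (Real.sqrt sA * Y₁ ω' - Real.sqrt sB * Y₂ ω')
      / Real.sqrt (max (sA + sB) ((sA + sB) / 2)))
      = fun ω' => (Real.sqrt sA * Y₁ ω' - Real.sqrt sB * Y₂ ω') / Real.sqrt (sA + sB) := by
    funext ω'
    rw [max_eq_left (by linarith)]
  rw [elim] at hsl
  -- the printed statistic: measurability, and eventual agreement with the Slutsky statistic
  have hXm : ∀ n : ℕ, Measurable fun ω : ΩA × ΩB =>
      Real.sqrt n * ((∑ i ∈ range n, wt (y i ω.1) * O (y i ω.1)) / (∑ i ∈ range n, wt (y i ω.1))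
        - a) - Real.sqrt n * ((∑ i ∈ range n, wt' (y' i ω.2) * O (y' i ω.2))
          / (∑ i ∈ range n, wt' (y' i ω.2)) - a) := fun n =>
    ((((hSAm n).comp measurable_fst).sub_const a).const_mul _).sub
      ((((hSBm n).comp measurable_snd).sub_const a).const_mul _)
  have hTm : ∀ n : ℕ, Measurable fun ω : ΩA × ΩB =>
      ((∑ i ∈ range n, wt (y i ω.1) * O (y i ω.1)) / (∑ i ∈ range n, wt (y i ω.1))
        - (∑ i ∈ range n, wt' (y' i ω.2) * O (y' i ω.2)) / (∑ i ∈ range n, wt' (y' i ω.2)))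
      / Real.sqrt
        ((∑ i ∈ range n, wt (y i ω.1) ^ 2 * (O (y i ω.1)
            - (∑ j ∈ range n, wt (y j ω.1) * O (y j ω.1)) / (∑ j ∈ range n, wt (y j ω.1))) ^ 2)
          / (∑ i ∈ range n, wt (y i ω.1)) ^ 2
        + (∑ i ∈ range n, wt' (y' i ω.2) ^ 2 * (O (y' i ω.2)
            - (∑ j ∈ range n, wt' (y' j ω.2) * O (y' j ω.2)) / (∑ j ∈ range n, wt' (y' j ω.2)))
              ^ 2) / (∑ i ∈ range n, wt' (y' i ω.2)) ^ 2) := fun n =>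
    (((hSAm n).comp measurable_fst).sub ((hSBm n).comp measurable_snd)).div
      (((hVAm n).comp measurable_fst).add ((hVBm n).comp measurable_snd)).sqrt
  refine tendstoInDistribution_of_tendstoInMeasure_sub (μ'' := PA.prod PB) (μ' := P') _ _ hsl
    ?_ (fun n => (hTm n).aemeasurable)
  refine tendstoInMeasure_of_tendsto_ae
    (fun n => ((hTm n).sub ((hXm n).div ((hVm n).max measurable_const).sqrt)).aestronglyMeasurable)
    ?_
  filter_upwards [hVae] with ω hVω
  refine (tendsto_const_nhds (x := (0 : ℝ))).congr' ?_
  filter_upwards [hVω.eventually_const_lt (half_lt_self hs), eventually_ge_atTop 1] with n hn hn1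
  rw [Pi.sub_apply, Pi.sub_apply, max_eq_left hn.le, twoCode_studentise_eq hn1 _ _ a, sub_self]

end Agreement

end Summit.Ventures.LatticeQCDFlow.Scoring.CardConsistency

end
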